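import Summits.Ventures.CertifiedArithmetic.LowPrec.EnvelopeStructural
import Summits.Ventures.CertifiedArithmetic.LowPrec.RoundNearestJR
import Summits.Ventures.CertifiedArithmetic.LowPrec.SRBlockScaleRules

/-!
# Per-element quantisation-error ATOMS of the envelope tables (lemmas L5a–L5c)

HONEST FRAMING (venture CertifiedArithmetic / cell `pub-lowprec`): certified error envelopes and
provably optimal rounding/accumulation schemes for low-precision formats under stated cost models;
every table by two implementations; no hardware or vendor claims.

The cell's envelope programme (`envelope/THEOREM-SHAPES.md` §4.0, §4.0b, §7; certificate C56
`certs/enum/ENVELOPE-ATOMS.json`, two implementations agreeing on 288 per-binade cells and 52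
per-element atoms) rests on three per-element atoms. This file proves them for EVERY format:

* L5a `roundNERelSharp` — the SHARP standard model `|x - fl x| ≤ u/(1+u)·|x|` on the normal range
  `2^m·quantum ≤ |x| ≤ maxRat`. The bound itself is ALREADY in the tree
  (`MiniFloat.abs_sub_roundNE_le_sharp`, `EnvelopeStructural.lean`); here we add (i) a SECOND
  ROUTE through the Literature — [JeannerodRump2018, eq. (1.2)] for abstract round-to-nearest maps
  (`JeannerodRump2018.abs_sub_fl_le_sharp_pos`, hypothesis `2^(emin+p) ≤ t`, i.e. from the second
  normal binade on), transported by the bridge `Format.flJR_eq_roundNE`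
  (`MiniFloat.abs_sub_roundNE_le_sharp_of_JR`); (ii) TIGHTNESS for every format with
  `2^m + 1 ≤ maxScaled`: equality at `x = (2^m + 1/2)·quantum = (1+u)·2^m·quantum`
  (`MiniFloat.abs_sub_roundNE_sharp_attained`); (iii) the named values `u/(1+u) = 1/17, 1/9, 1/5,
  1/9, 1/17` (E4M3, E5M2, E2M1, E3M2, E2M3) and the C56 witnesses by kernel evaluation.
* The ABSOLUTE atom `MiniFloat.abs_sub_roundNE_le_unitRoundoff_mul_pow_emaxElem`: for
  `|x| ≤ maxRat`, `|x - fl x| ≤ u · 2^emaxElem` (half the top binade's spacing).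
* L5b `mxCeilAtom` — MX block with the power-of-two CEIL scale `X = 2^⌈log₂(amax/maxRat)⌉` and
  RNE elements: an element normal after scaling has error `≤ u/(1+u) · amax`.
* L5c `vecIdealAtom` — per-vector ideal scale `s = amax/maxRat` (the maximum maps to `maxRat`
  exactly): EVERY element has error `≤ u · 2^emaxElem / maxRat · amax` (E4M3 `1/28`, E5M2 `1/14`,
  E2M1 `1/6`).

References: [JeannerodRump2018] eq. (1.2), Thm 2.1 (optimal bound and its attainment);
[Higham2002ASNA] Thm 2.2; [RouhaniEtAl2023MX] §3 (block maximum, shared scale);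
[MicikeviciusEtAl2022] Table 1 (format constants).

Placement: venture development under `Summits/Ventures/CertifiedArithmetic/`; datum-level
statements are dot-notation extensions of the Literature structure `MiniFloat` (CONVENTIONS §2);
the block-level atoms live in `Summit.Ventures.CertifiedArithmetic.LowPrec.EnvelopeAtoms`.
-/

namespace Literature.ComputerArithmetic.FloatingPoint

namespace MiniFloat

variable {φ : Format}

/-- SECOND ROUTE through the Literature: from the second normal binade on
(`2^(m+1) · quantum ≤ |x| ≤ maxRat`) the sharp bound is [JeannerodRump2018, eq. (1.2)] for the
round-to-nearest map `flJR φ` into `F(m+1, qexp)`, transported to the saturating executable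
rounding by the bridge `flJR_eq_roundNE`. [cite: JeannerodRump2018, eq. (1.2)] -/
theorem abs_sub_roundNE_le_sharp_of_JR {x : ℚ} (hlo : 2 ^ (φ.manBits + 1) * φ.quantum ≤ |x|)
    (hhi : |x| ≤ φ.maxRat) :
    |x - (roundNE φ x).toRat| ≤ φ.unitRoundoff / (1 + φ.unitRoundoff) * |x| := by
  -- the error depends on |x| only
  have hsymm : |x - (roundNE φ x).toRat| = |(|x|) - (roundNE φ |x|).toRat| := by
    rw [abs_sub_roundNE, abs_sub_roundNE, abs_abs]
  rw [hsymm, ← Format.flJR_eq_roundNE (by rwa [abs_abs])]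
  have hJR := JeannerodRump2018.abs_sub_fl_le_sharp_pos (p := φ.manBits + 1) (emin := φ.qexp)
    (fl := φ.flJR) (by omega) (Format.isRoundNearest_flJR φ) (t := |x|) ?_
  · have hu : JeannerodRump2018.unitRoundoff (φ.manBits + 1) = φ.unitRoundoff := by
      rw [JeannerodRump2018.unitRoundoff, Format.unitRoundoff_eq]
    rwa [hu] at hJR
  · -- 2^(qexp + (m+1)) = 2^(m+1) · quantum
    have : (2 : ℚ) ^ (φ.qexp + ((φ.manBits + 1 : ℕ) : ℤ)) = 2 ^ (φ.manBits + 1) * φ.quantum := by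
      rw [zpow_add₀ (by norm_num), zpow_natCast, mul_comm]; rfl
    rw [this]; exact hlo

/-- TIGHTNESS of `u/(1+u)`: at `x = (2^m + 1/2) · quantum = (1 + u) · 2^m · quantum` (the first
midpoint of the first normal binade; in range as soon as `2^m + 1 ≤ maxScaled`) the error EQUALS
`u/(1+u) · |x|` (`= quantum / 2`), for every format. [cite: JeannerodRump2018, Thm 2.1] -/
theorem abs_sub_roundNE_sharp_attained (h : 2 ^ φ.manBits + 1 ≤ φ.maxScaled) :
    |(2 ^ φ.manBits + 1 / 2) * φ.quantum - (roundNE φ ((2 ^ φ.manBits + 1 / 2) * φ.quantum)).toRat|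
      = φ.unitRoundoff / (1 + φ.unitRoundoff) * |(2 ^ φ.manBits + 1 / 2) * φ.quantum| := by
  have hq := φ.quantum_pos
  have hxpos : 0 < ((2 : ℚ) ^ φ.manBits + 1 / 2) * φ.quantum := by positivity
  have habs : |((2 : ℚ) ^ φ.manBits + 1 / 2) * φ.quantum| = (2 ^ φ.manBits + 1 / 2) * φ.quantum :=
    abs_of_pos hxpos
  have hr : |((2 : ℚ) ^ φ.manBits + 1 / 2) * φ.quantum| / φ.quantum = 2 ^ φ.manBits + 1 / 2 := by
    rw [habs, mul_div_cancel_right₀ _ (ne_of_gt hq)]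
  rw [abs_sub_roundNE, hr, habs]
  set r : ℚ := 2 ^ φ.manBits + 1 / 2 with hrdef
  have hr0 : 0 ≤ r := by positivity
  -- upper bound: 2^m is representable and at distance 1/2
  have hrep : φ.Representable (2 ^ φ.manBits) :=
    representable_of_lt_pow (Nat.pow_lt_pow_right (by norm_num) (by omega)) (by omega)
  have hup := Format.abs_sub_rneGrid_le hr0 hrep
  push_cast at hup
  rw [show r - 2 ^ φ.manBits = 1 / 2 by rw [hrdef]; ring,
    abs_of_pos (by norm_num : (0 : ℚ) < 1 / 2)] at hup
  -- lower bound: r is a half-integer and rneGrid r an integer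
  have hlow : 1 / 2 ≤ |r - (φ.rneGrid r : ℕ)| := by
    have key : ∀ N : ℤ, (1 : ℚ) / 2 ≤ |r - N| := by
      intro N
      rw [hrdef]
      have e2 : ((2 : ℚ) ^ φ.manBits) = ((2 ^ φ.manBits : ℤ) : ℚ) := by push_cast; rfl
      rw [e2]
      rcases le_or_gt N (2 ^ φ.manBits : ℤ) with hN | hN
      · have : (N : ℚ) ≤ ((2 ^ φ.manBits : ℤ) : ℚ) := by exact_mod_cast hN
        rw [abs_of_nonneg (by linarith)]; linarith
      · have : ((2 ^ φ.manBits : ℤ) : ℚ) + 1 ≤ (N : ℚ) := by exact_mod_cast hN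
        rw [abs_of_nonpos (by linarith)]; linarith
    have := key (φ.rneGrid r : ℕ)
    push_cast at this
    exact this
  have heq : |r - (φ.rneGrid r : ℕ)| = 1 / 2 := le_antisymm hup hlow
  rw [heq, Format.unitRoundoff_eq, hrdef, pow_succ]
  field_simp

/-- ABSOLUTE ATOM: on the whole finite range `|x| ≤ maxRat` the error of round-to-nearest-even is
at most half the spacing of the TOP binade, `2^(emaxCode-1) · quantum / 2 = u · 2^emaxElem`.
[cite: Higham2002ASNA, Thm 2.2] -/
theorem abs_sub_roundNE_le_unitRoundoff_mul_pow_emaxElem (h1 : 1 ≤ φ.emaxCode) {x : ℚ}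
    (h : |x| ≤ φ.maxRat) :
    |x - (roundNE φ x).toRat| ≤ φ.unitRoundoff * (2 : ℚ) ^ φ.emaxElem := by
  have hq := φ.quantum_pos
  refine le_trans (abs_sub_roundNE_le_half_spacing h) ?_
  have hs := Format.shift_le (φ := φ) ⌊|x| / φ.quantum⌋.toNat
  have hpow : (2 : ℚ) ^ φ.shift ⌊|x| / φ.quantum⌋.toNat ≤ 2 ^ (φ.emaxCode - 1) :=
    pow_le_pow_right₀ (by norm_num) hs
  have key : (2 : ℚ) ^ (φ.emaxCode - 1) / 2 * φ.quantum = φ.unitRoundoff * (2 : ℚ) ^ φ.emaxElem := by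
    have h2 : (2 : ℚ) ≠ 0 := by norm_num
    have e1 : (2 : ℚ) ^ (φ.emaxCode - 1) = (2 : ℚ) ^ ((φ.emaxCode : ℤ) - 1) := by
      rw [← zpow_natCast, Nat.cast_sub h1]; norm_num
    unfold Format.quantum Format.unitRoundoff Format.emaxElem Format.qexp
    rw [e1, div_eq_mul_inv, ← zpow_neg_one, ← zpow_add₀ h2, ← zpow_add₀ h2, ← zpow_add₀ h2]
    congr 1; ring
  calc (2 : ℚ) ^ φ.shift ⌊|x| / φ.quantum⌋.toNat / 2 * φ.quantum
      ≤ (2 : ℚ) ^ (φ.emaxCode - 1) / 2 * φ.quantum := by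
        refine mul_le_mul_of_nonneg_right ?_ hq.le; linarith
    _ = φ.unitRoundoff * (2 : ℚ) ^ φ.emaxElem := key

end MiniFloat

end Literature.ComputerArithmetic.FloatingPoint

namespace Summit.Ventures.CertifiedArithmetic.LowPrec.EnvelopeAtoms

open Literature.ComputerArithmetic.FloatingPoint
open Literature.ComputerArithmetic.FloatingPoint.Format
open Literature.ComputerArithmetic.FloatingPoint.MiniFloat
open Literature.ComputerArithmetic.FloatingPoint.MXBlock
open Summit.Ventures.CertifiedArithmetic.LowPrec.SR

/-- L5a `RoundNERelSharp` of the cell's THEOREM-SHAPES §7, verbatim: for every format and every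
rational in its normal range, round-to-nearest-even (saturating) has relative error at most
`u/(1+u)` — the tree's `MiniFloat.abs_sub_roundNE_le_sharp`. [cite: JeannerodRump2018, eq. (1.2)] -/
theorem roundNERelSharp :
    ∀ (φ : Format) (x : ℚ), 2 ^ φ.manBits * φ.quantum ≤ |x| → |x| ≤ φ.maxRat →
      |x - (roundNE φ x).toRat| ≤ φ.unitRoundoff / (1 + φ.unitRoundoff) * |x| :=
  fun _ _ hlo hhi => abs_sub_roundNE_le_sharp hlo hhi

/-- L5b `MXCeilAtom`, verbatim: in an MX block with the power-of-two ceil scale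
`X = ceilScale φ V` (no element clips: `blockMax V ≤ X · maxRat`) and RNE elements, an element
that is normal after scaling (`2^m · quantum ≤ |V i| / X`) is reproduced with error at most
`u/(1+u) · blockMax V`. [cite: RouhaniEtAl2023MX, §3] -/
theorem mxCeilAtom :
    ∀ (φ : Format) (k : ℕ) (V : Fin k → ℚ) (i : Fin k), 0 < φ.maxRat →
      2 ^ φ.manBits * φ.quantum ≤ |V i| / ceilScale φ V →
      |V i - ceilScale φ V * (roundNE φ (V i / ceilScale φ V)).toRat|
        ≤ φ.unitRoundoff / (1 + φ.unitRoundoff) * blockMax V := by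
  intro φ k V i hM hlo
  have hX := ceilScale_pos φ V
  have hu' : 0 ≤ φ.unitRoundoff / (1 + φ.unitRoundoff) :=
    div_nonneg φ.unitRoundoff_pos.le (by linarith [φ.unitRoundoff_pos])
  have habs : |V i / ceilScale φ V| = |V i| / ceilScale φ V := by rw [abs_div, abs_of_pos hX]
  have hhi : |V i / ceilScale φ V| ≤ φ.maxRat := by
    rw [habs, div_le_iff₀ hX, mul_comm]
    exact le_trans (abs_le_blockMax V i) (blockMax_le_ceilScale_mul hM V)
  have h := abs_sub_roundNE_le_sharp (φ := φ) (x := V i / ceilScale φ V) (by rwa [habs]) hhi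
  have hfac : V i - ceilScale φ V * (roundNE φ (V i / ceilScale φ V)).toRat
      = ceilScale φ V * (V i / ceilScale φ V - (roundNE φ (V i / ceilScale φ V)).toRat) := by
    rw [mul_sub, mul_div_cancel₀ _ (ne_of_gt hX)]
  rw [hfac, abs_mul, abs_of_pos hX]
  calc ceilScale φ V * |V i / ceilScale φ V - (roundNE φ (V i / ceilScale φ V)).toRat|
      ≤ ceilScale φ V * (φ.unitRoundoff / (1 + φ.unitRoundoff) * |V i / ceilScale φ V|) :=
        mul_le_mul_of_nonneg_left h hX.le
    _ = φ.unitRoundoff / (1 + φ.unitRoundoff) * |V i| := by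
        rw [habs, mul_left_comm, mul_div_cancel₀ _ (ne_of_gt hX)]
    _ ≤ φ.unitRoundoff / (1 + φ.unitRoundoff) * blockMax V :=
        mul_le_mul_of_nonneg_left (abs_le_blockMax V i) hu'

/-- L5c `VecIdealAtom`, verbatim: with the ideal per-vector scale `s = blockMax V / maxRat` (the
maximum is mapped to `maxRat` exactly, so no element clips) EVERY element of a nonzero vector is
reproduced by RNE with error at most `u · 2^emaxElem / maxRat · blockMax V` — the absolute atom
scaled back. [cite: RouhaniEtAl2023MX, §3] -/
theorem vecIdealAtom :
    ∀ (φ : Format) (k : ℕ) (V : Fin k → ℚ) (i : Fin k), 1 ≤ φ.emaxCode → 0 < blockMax V →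
      |V i - (blockMax V / φ.maxRat) * (roundNE φ (V i / (blockMax V / φ.maxRat))).toRat|
        ≤ φ.unitRoundoff * (2 : ℚ) ^ φ.emaxElem / φ.maxRat * blockMax V := by
  intro φ k V i h1 hB
  have hM : 0 < φ.maxRat :=
    lt_of_lt_of_le (zpow_pos (by norm_num) _) (Format.pow_emaxElem_le_maxRat φ h1)
  set s := blockMax V / φ.maxRat with hsdef
  have hs : 0 < s := div_pos hB hM
  have habs : |V i / s| = |V i| / s := by rw [abs_div, abs_of_pos hs]
  have hhi : |V i / s| ≤ φ.maxRat := by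
    rw [habs, div_le_iff₀ hs]
    have : φ.maxRat * s = blockMax V := by rw [hsdef, mul_div_cancel₀ _ (ne_of_gt hM)]
    rw [this]; exact abs_le_blockMax V i
  have h := abs_sub_roundNE_le_unitRoundoff_mul_pow_emaxElem (φ := φ) h1 hhi
  have hfac : V i - s * (roundNE φ (V i / s)).toRat = s * (V i / s - (roundNE φ (V i / s)).toRat) := by
    rw [mul_sub, mul_div_cancel₀ _ (ne_of_gt hs)]
  rw [hfac, abs_mul, abs_of_pos hs]
  calc s * |V i / s - (roundNE φ (V i / s)).toRat|
      ≤ s * (φ.unitRoundoff * (2 : ℚ) ^ φ.emaxElem) := mul_le_mul_of_nonneg_left h hs.le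
    _ = φ.unitRoundoff * (2 : ℚ) ^ φ.emaxElem / φ.maxRat * blockMax V := by
        rw [hsdef]; field_simp

/-- The per-element RELATIVE atom `u' = u/(1+u)` of the envelope tables' element formats:
`1/17` (E4M3), `1/9` (E5M2), `1/5` (E2M1), `1/9` (E3M2), `1/17` (E2M3).
[cite: MicikeviciusEtAl2022, Table 1] -/
theorem sharpUnit_values :
    E4M3.unitRoundoff / (1 + E4M3.unitRoundoff) = 1 / 17 ∧
    E5M2.unitRoundoff / (1 + E5M2.unitRoundoff) = 1 / 9 ∧
    E2M1.unitRoundoff / (1 + E2M1.unitRoundoff) = 1 / 5 ∧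
    E3M2.unitRoundoff / (1 + E3M2.unitRoundoff) = 1 / 9 ∧
    E2M3.unitRoundoff / (1 + E2M3.unitRoundoff) = 1 / 17 := by
  obtain ⟨h1, h2, h3, h4, h5, -⟩ := unitRoundoff_values
  refine ⟨?_, ?_, ?_, ?_, ?_⟩
  · rw [h4]; norm_num
  · rw [h5]; norm_num
  · rw [h1]; norm_num
  · rw [h2]; norm_num
  · rw [h3]; norm_num

/-- The per-vector IDEAL-SCALE atom `u · 2^emaxElem / maxRat` of the three element formats of
the envelope tables: `1/28` (E4M3: `16/448`), `1/14` (E5M2: `4096/57344`), `1/6` (E2M1: `1/6`).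
[cite: MicikeviciusEtAl2022, Table 1] -/
theorem vecIdealUnit_values :
    E4M3.unitRoundoff * (2 : ℚ) ^ E4M3.emaxElem / E4M3.maxRat = 1 / 28 ∧
    E5M2.unitRoundoff * (2 : ℚ) ^ E5M2.emaxElem / E5M2.maxRat = 1 / 14 ∧
    E2M1.unitRoundoff * (2 : ℚ) ^ E2M1.emaxElem / E2M1.maxRat = 1 / 6 := by
  refine ⟨by decide +kernel, by decide +kernel, by decide +kernel⟩

/-- The C56 witnesses of certificate `certs/enum/ENVELOPE-ATOMS.json` (route B-2, normal-range
relative atom): E4M3 at `17/1024 = (1+u)·2^-6` is rounded to `1/64` with error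
`1/1024 = (1/17)·(17/1024)`; E5M2 at `9/65536 = (1+u)·2^-13` to `1/8192`, error `(1/9)·(9/65536)`;
E2M1 at `5/4 = (1+u)·1` to `1`, error `(1/5)·(5/4)` — `roundNE` evaluated in the kernel.
[cite: MicikeviciusEtAl2022, Table 1] -/
theorem sharp_witness_table :
    (roundNE E4M3 (17 / 1024)).toRat = 1 / 64 ∧ |(17 / 1024 : ℚ) - 1 / 64| = 1 / 17 * (17 / 1024) ∧
    (roundNE E5M2 (9 / 65536)).toRat = 1 / 8192 ∧
      |(9 / 65536 : ℚ) - 1 / 8192| = 1 / 9 * (9 / 65536) ∧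
    (roundNE E2M1 (5 / 4)).toRat = 1 ∧ |(5 / 4 : ℚ) - 1| = 1 / 5 * (5 / 4) := by
  refine ⟨by decide +kernel, by norm_num, by decide +kernel, by norm_num, by decide +kernel,
    by norm_num⟩

/-- The general tightness statement instantiated: E4M3, E5M2 and E2M1 attain `u/(1+u)` at
`(2^m + 1/2) · quantum`. [cite: JeannerodRump2018, Thm 2.1] -/
theorem sharp_attained_OCP :
    |(2 ^ E4M3.manBits + 1 / 2) * E4M3.quantum
        - (roundNE E4M3 ((2 ^ E4M3.manBits + 1 / 2) * E4M3.quantum)).toRat|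
      = E4M3.unitRoundoff / (1 + E4M3.unitRoundoff)
          * |(2 ^ E4M3.manBits + 1 / 2) * E4M3.quantum| ∧
    |(2 ^ E5M2.manBits + 1 / 2) * E5M2.quantum
        - (roundNE E5M2 ((2 ^ E5M2.manBits + 1 / 2) * E5M2.quantum)).toRat|
      = E5M2.unitRoundoff / (1 + E5M2.unitRoundoff)
          * |(2 ^ E5M2.manBits + 1 / 2) * E5M2.quantum| ∧
    |(2 ^ E2M1.manBits + 1 / 2) * E2M1.quantum
        - (roundNE E2M1 ((2 ^ E2M1.manBits + 1 / 2) * E2M1.quantum)).toRat|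
      = E2M1.unitRoundoff / (1 + E2M1.unitRoundoff)
          * |(2 ^ E2M1.manBits + 1 / 2) * E2M1.quantum| :=
  ⟨abs_sub_roundNE_sharp_attained (φ := E4M3) (by decide),
    abs_sub_roundNE_sharp_attained (φ := E5M2) (by decide),
    abs_sub_roundNE_sharp_attained (φ := E2M1) (by decide)⟩

end Summit.Ventures.CertifiedArithmetic.LowPrec.EnvelopeAtoms
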